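import Mathlib
import HarnessLib
import Summits.SmoothPoincare4.SmoothPoincare4.Theorems.ConvexBisectionAcyclicBisectionRigidityStubMatsumotoNormalFormAux2

/-!
# Matsumoto's normal form for four-letter genus-one words, III: the move table, alternating class

Helper file for stub D-alg (`stub_matsumotoNormalForm`), line `folded-curve-branch-locus`, crux
`ConvexBisection.AcyclicBisectionRigidity` (item stmt-SmoothPoincare4-10507).  Pure integer
arithmetic.  For the six pairings `a = ω₁₂, b = ω₁₃, c = ω₁₄, d = ω₂₃, e = ω₂₄, f = ω₃₄` and the
signs `s₁ … s₄` of a four-letter genus-one word, `Matsumoto.SomeMoveDecreases` lists the six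
inequalities "the signed Hurwitz move `k` strictly decreases `|a| + ⋯ + |f|`" (both alternatives of
`HurwitzStep` at the three positions).  `helper_class_alt`: in the alternating sign class
`(s, −s, s, −s)` the trivial-monodromy identities (`PL, A11, A12` and the trace identities
`T1, T2` of part I) give `d = ±c`, `f = ±a`, `e = ±b − s a c`; the wrong relative sign of `d/c`
and `f/a` contradicts `a ≠ 0`, the right one yields the constraint `b (b − t a c) = a² + c²` of
`helper_core_alt` (part II), whose four inequalities are four of the six moves.

Reference: Y. Matsumoto, J. Math. Soc. Japan 37 (1985), Thm. 3.2.  Everything is proved.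
-/

set_option linter.dupNamespace false

namespace Summit.SmoothPoincare4.SmoothPoincare4.Theorems.AcyclicBisectionRigidity.FoldedCurveBranchLocus

namespace Matsumoto

/-- The six candidate inequalities "move `k` strictly decreases `Σ|ω|`", for the six signed Hurwitz
moves on a four-letter word with pairings `a = ω₁₂, b = ω₁₃, c = ω₁₄, d = ω₂₃, e = ω₂₄, f = ω₃₄` and
signs `s₁ … s₄`. [folklore] -/
def SomeMoveDecreases (a b c d e f s₁ s₂ s₃ s₄ : ℤ) : Prop :=
  |d + s₁ * a * b| + |e + s₁ * a * c| < |d| + |e| ∨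
  |c + s₂ * a * e| + |b + s₂ * a * d| < |b| + |c| ∨
  |f + s₂ * d * e| + |b + s₂ * d * a| < |b| + |f| ∨
  |a + s₃ * d * b| + |e + s₃ * d * f| < |a| + |e| ∨
  |c + s₃ * f * b| + |e + s₃ * f * d| < |c| + |e| ∨
  |d + s₄ * f * e| + |b + s₄ * f * c| < |b| + |d|

end Matsumoto

/-- **Alternating class** `(s, −s, s, −s)`: some move decreases the complexity. [folklore] -/
theorem helper_class_alt (s₁ a b c d e f : ℤ) (hs₁ : s₁ = 1 ∨ s₁ = -1)
    (ha : a ≠ 0) (hc : c ≠ 0)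
    (hPL : a * f - b * e + c * d = 0)
    (hA11 : -(-s₁) * a ^ 2 = s₁ * b ^ 2 + (-s₁) * c ^ 2 + s₁ * (-s₁) * f * b * c)
    (hA12 : 0 = s₁ * b * d + (-s₁) * c * e + s₁ * (-s₁) * f * c * d)
    (hT1 : a * (s₁ * (-s₁) * a ^ 2 - s₁ * (-s₁) * f ^ 2) = 0)
    (hT2 : c * (s₁ * (-s₁) * c ^ 2 - (-s₁) * s₁ * d ^ 2) = 0) :
    Matsumoto.SomeMoveDecreases a b c d e f s₁ (-s₁) s₁ (-s₁) := by
  have hs2 : s₁ * s₁ = 1 := by rcases hs₁ with rfl | rfl <;> norm_num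
  have hs0 : s₁ ≠ 0 := by rcases hs₁ with rfl | rfl <;> norm_num
  have hs₁' : -s₁ = 1 ∨ -s₁ = -1 := by rcases hs₁ with rfl | rfl <;> norm_num
  have hfa : f ^ 2 = a ^ 2 := by
    have h1 : a * (f ^ 2 - a ^ 2) = 0 := by linear_combination hT1 + (-(a * (f ^ 2 - a ^ 2))) * hs2
    exact sub_eq_zero.mp ((mul_eq_zero.mp h1).resolve_left ha)
  have hdc : d ^ 2 = c ^ 2 := by
    have h1 : c * (d ^ 2 - c ^ 2) = 0 := by linear_combination hT2 + (-(c * (d ^ 2 - c ^ 2))) * hs2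
    exact sub_eq_zero.mp ((mul_eq_zero.mp h1).resolve_left hc)
  unfold Matsumoto.SomeMoveDecreases
  rcases sq_eq_sq_iff_eq_or_eq_neg.mp hdc with hd | hd <;>
    rcases sq_eq_sq_iff_eq_or_eq_neg.mp hfa with hf | hf
  · -- ρ = 1, θ = 1 : valid, t = s₁, e = b - s₁ a c
    rw [eq_comm] at hd hf
    subst hd hf
    have hL : c * (-(a * c * s₁ ^ 2) + b * s₁ + -(e * s₁)) = 0 :=
        by linear_combination (-1 : ℤ) * hA12
    have hL' := (mul_eq_zero.mp hL).resolve_left hc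
    have he : e = -(a * c * s₁) + b :=
        by linear_combination (-s₁) * hL' + (-(a * c * s₁) + -e + b) * hs2
    subst he
    have hcons : b * (b - s₁ * a * c) = a ^ 2 + c ^ 2 := by
      linear_combination (-s₁) * hA11 + (a ^ 2 + a * b * c * s₁ + -(b ^ 2) + c ^ 2) * hs2
    have hcore := helper_core_alt a c b s₁ hs₁ ha hc hcons
    rcases hcore with hi | hi | hi | hi
    · refine Or.inl ?_
      rcases hs₁ with rfl | rfl <;> convert hi using 2 <;>
        exact (sq_eq_sq_iff_abs_eq_abs _ _).mp (by ring)
    · refine Or.inr (Or.inr (Or.inr (Or.inl ?_)))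
      rcases hs₁ with rfl | rfl <;> convert hi using 2 <;>
        exact (sq_eq_sq_iff_abs_eq_abs _ _).mp (by ring)
    · refine Or.inr (Or.inl ?_)
      rcases hs₁ with rfl | rfl <;> convert hi using 2 <;>
        exact (sq_eq_sq_iff_abs_eq_abs _ _).mp (by ring)
    · refine Or.inr (Or.inr (Or.inl ?_))
      rcases hs₁ with rfl | rfl <;> convert hi using 2 <;>
        exact (sq_eq_sq_iff_abs_eq_abs _ _).mp (by ring)
  · -- ρ = 1, θ = -1 : contradiction
    exfalso
    rw [eq_comm] at hd
    subst hd hf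
    have hL : c * (a * c * s₁ ^ 2 + b * s₁ + -(e * s₁)) = 0 := by linear_combination (-1 : ℤ) * hA12
    have hL' := (mul_eq_zero.mp hL).resolve_left hc
    have he : e = a * c * s₁ + b := by linear_combination (-s₁) * hL' + (a * c * s₁ + -e + b) * hs2
    subst he
    have h2 : 2 * a ^ 2 * s₁ = 0 := by linear_combination hA11 + (-s₁) * hPL
    have : a ^ 2 = 0 := by
      rcases mul_eq_zero.mp h2 with h | h
      · simpa using h
      · exact absurd h hs0
    exact ha (pow_eq_zero_iff two_ne_zero |>.mp this)
  · -- ρ = -1, θ = 1 : contradiction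
    exfalso
    rw [eq_comm] at hf
    subst hd hf
    have hL : c * (a * c * s₁ ^ 2 + -(b * s₁) + -(e * s₁)) = 0 :=
        by linear_combination (-1 : ℤ) * hA12
    have hL' := (mul_eq_zero.mp hL).resolve_left hc
    have he : e = a * c * s₁ + -b :=
        by linear_combination (-s₁) * hL' + (a * c * s₁ + -e + -b) * hs2
    subst he
    have h2 : 2 * a ^ 2 * s₁ = 0 := by linear_combination hA11 + s₁ * hPL
    have : a ^ 2 = 0 := by
      rcases mul_eq_zero.mp h2 with h | h
      · simpa using h
      · exact absurd h hs0
    exact ha (pow_eq_zero_iff two_ne_zero |>.mp this)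
  · -- ρ = -1, θ = -1 : valid, t = -s₁, e = -b - s₁ a c
    subst hd hf
    have hL : c * (-(a * c * s₁ ^ 2) + -(b * s₁) + -(e * s₁)) = 0 :=
        by linear_combination (-1 : ℤ) * hA12
    have hL' := (mul_eq_zero.mp hL).resolve_left hc
    have he : e = -(a * c * s₁) + -b :=
        by linear_combination (-s₁) * hL' + (-(a * c * s₁) + -e + -b) * hs2
    subst he
    have hcons : b * (b - (-s₁) * a * c) = a ^ 2 + c ^ 2 := by
      linear_combination (-s₁) * hA11 + (a ^ 2 + -(a * b * c * s₁) + -(b ^ 2) + c ^ 2) * hs2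
    have hcore := helper_core_alt a c b (-s₁) hs₁' ha hc hcons
    rcases hcore with hi | hi | hi | hi
    · refine Or.inl ?_
      rcases hs₁ with rfl | rfl <;> convert hi using 2 <;>
        exact (sq_eq_sq_iff_abs_eq_abs _ _).mp (by ring)
    · refine Or.inr (Or.inr (Or.inr (Or.inl ?_)))
      rcases hs₁ with rfl | rfl <;> convert hi using 2 <;>
        exact (sq_eq_sq_iff_abs_eq_abs _ _).mp (by ring)
    · refine Or.inr (Or.inl ?_)
      rcases hs₁ with rfl | rfl <;> convert hi using 2 <;>
        exact (sq_eq_sq_iff_abs_eq_abs _ _).mp (by ring)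
    · refine Or.inr (Or.inr (Or.inl ?_))
      rcases hs₁ with rfl | rfl <;> convert hi using 2 <;>
        exact (sq_eq_sq_iff_abs_eq_abs _ _).mp (by ring)

end Summit.SmoothPoincare4.SmoothPoincare4.Theorems.AcyclicBisectionRigidity.FoldedCurveBranchLocus
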